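import Literature.Computability.QuantumComplexity.IQPPostselection
import HarnessLib

/-!
# Multiplicative simulation transfers post-selected decisions (BJS 2011, proof of Thm. 2)

Family `quantum-advantage`; refines the named fact `mem_PostBPP_of_samplesMultiplicative` of
`IQPPostselection.lean` (the argument of Bremner–Jozsa–Shepherd 2011, Thm. 2, arXiv:1005.1407
p. 8, eqs. (5)–(8)) into

* its **probability-theoretic content, proved here**: if a sampler `A` weakly simulates a sampling
  problem `D` to multiplicative error `c ≥ 1` (`RandAlg.SamplesMultiplicative`, BJS eq. (2)), then
  every event — in particular every marginal on a sub-register — obeys the same bounds (BJS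
  eq. (6) and the sentence after it), post-selected probabilities change by at most a factor `c²`
  (eq. (8): `S/c² ≤ S̃ ≤ c² S`), and hence a post-selected decision with tolerance `ε` becomes a
  post-selected decision of the sampler with tolerance
  `ε' = max (1 - (1-ε)/c²) (c² ε) < 1/2` as soon as `c² < 2 - 2ε` (`= 1 + 2δ`)
  (`SamplesMultiplicative.toReal_toOuterMeasure_le/ge`, `postselected_decision`,
  `PostIQPFamily.PostDecides.samplerPostDecides`);
* two residual named facts of machine plumbing: `mem_PostBPPWith_of_samplerPostDecides` (the
  register statistics of a uniform PPT sampler are the statistics of two `P`-predicates on its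
  coin string — the definition of post-BPP, BJS Def. 3 / §2.2) and `PostBPPWith_subset_PostBPP`
  (post-BPP does not depend on the error tolerance, BJS §2.4; Han–Hemaspaandra–Thierauf 1997,
  Thm. 3.1);
* and the proved assembly `mem_PostBPP_of_samplesMultiplicative_of`.

Mathlib: `PMF.toOuterMeasure_apply` (event probability as a `tsum` of an indicator),
`ENNReal.tsum_le_tsum`, `ENNReal.tsum_mul_left`. Design: event probabilities are
`(p.toOuterMeasure E).toReal : ℝ` as elsewhere in the tree (`RandAlg.pr`,
`QCircuitFamily.kernelProb`, `PostIQPFamily.postselectProbOn`); the generic lemmas are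
dot-notation extensions in the namespace `Literature.Computability.Complexity.RandAlg.SamplesMultiplicative` of the
prelude predicate (deliberate, as for `SamplesMultiplicative` itself in `SamplingProblems.lean`);
`PostBPPWith ε` generalises the thresholds `2/3, 1/3` of the tree's `PostBPP` to `1-ε, ε` with
literally the same shape (`PostBPPWith_one_third : PostBPPWith (1/3) = PostBPP`).
-/

open Computability Literature.Computability.Cryptography

namespace Literature.Computability.Complexity.RandAlg.SamplesMultiplicative

variable {A : RandAlg (List Bool) (List Bool)} {D : SamplingProblem} {c : ℝ}

/-- Pointwise upper bound in `ℝ≥0∞` form: `Pr[A(x) = y] ≤ c · D_x(y)`.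
(BJS 2011, §2.5 (c), eq. (2).) [cite: BremnerJozsaShepherdPRSA2011, §2.5 (c) eq. (2)] -/
theorem apply_le (h : A.SamplesMultiplicative D c) (hc : 0 ≤ c) (x y : List Bool) :
    A.outputPMF id x y ≤ ENNReal.ofReal c * D x y := by
  have h2 := (h x y).2
  rw [← ENNReal.ofReal_toReal ((A.outputPMF id x).apply_ne_top y),
    ← ENNReal.ofReal_toReal ((D x).apply_ne_top y), ← ENNReal.ofReal_mul hc]
  exact ENNReal.ofReal_le_ofReal h2

/-- Pointwise lower bound in `ℝ≥0∞` form: `D_x(y) ≤ c · Pr[A(x) = y]` (from `D_x(y)/c ≤ Pr[A(x)=y]`,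
`c ≥ 1`). (BJS 2011, §2.5 (c), eq. (2).) [cite: BremnerJozsaShepherdPRSA2011, §2.5 (c) eq. (2)] -/
theorem le_apply (h : A.SamplesMultiplicative D c) (hc : 1 ≤ c) (x y : List Bool) :
    D x y ≤ ENNReal.ofReal c * A.outputPMF id x y := by
  have hc0 : 0 < c := lt_of_lt_of_le one_pos hc
  have h1 := (h x y).1
  rw [div_le_iff₀ hc0] at h1
  rw [← ENNReal.ofReal_toReal ((A.outputPMF id x).apply_ne_top y),
    ← ENNReal.ofReal_toReal ((D x).apply_ne_top y), ← ENNReal.ofReal_mul hc0.le]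
  exact ENNReal.ofReal_le_ofReal (by linarith [mul_comm ((A.outputPMF id x y).toReal) c])

/-- Events inherit a pointwise bound: `μ(E) ≤ k · ν(E)` in `ℝ≥0∞` whenever `μ ≤ k · ν` pointwise
(sum the indicator of `E`). [folklore] -/
theorem toOuterMeasure_le_of_apply_le {p q : PMF (List Bool)} {k : ENNReal}
    (hpq : ∀ y, p y ≤ k * q y) (E : Set (List Bool)) :
    p.toOuterMeasure E ≤ k * q.toOuterMeasure E := by
  rw [PMF.toOuterMeasure_apply, PMF.toOuterMeasure_apply, ← ENNReal.tsum_mul_left]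
  refine ENNReal.tsum_le_tsum fun y => ?_
  by_cases hy : y ∈ E
  · simp only [Set.indicator_of_mem hy]
    exact hpq y
  · simp [Set.indicator_of_notMem hy]

/-- **Events (marginals) obey the multiplicative upper bound**: `Pr[A(x) ∈ E] ≤ c · D_x(E)` for
every event `E`. (BJS 2011, proof of Thm. 2, eq. (6): "all marginal distributions for
corresponding sub-registers satisfy the same inequality".) [cite: BremnerJozsaShepherdPRSA2011, Thm. 2 (proof, eq. (6))] -/
theorem toReal_toOuterMeasure_le (h : A.SamplesMultiplicative D c) (hc : 1 ≤ c) (x : List Bool)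
    (E : Set (List Bool)) :
    ((A.outputPMF id x).toOuterMeasure E).toReal ≤ c * ((D x).toOuterMeasure E).toReal := by
  have hc0 : 0 ≤ c := le_trans zero_le_one hc
  have hE := toOuterMeasure_le_of_apply_le (fun y => apply_le h hc0 x y) E
  have hfin : ENNReal.ofReal c * (D x).toOuterMeasure E ≠ ⊤ := by
    refine ENNReal.mul_ne_top ENNReal.ofReal_ne_top ?_
    rw [PMF.toOuterMeasure_apply]
    exact (D x).tsum_coe_indicator_ne_top E
  calc ((A.outputPMF id x).toOuterMeasure E).toReal
      ≤ (ENNReal.ofReal c * (D x).toOuterMeasure E).toReal := ENNReal.toReal_mono hfin hE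
    _ = c * ((D x).toOuterMeasure E).toReal := by
        rw [ENNReal.toReal_mul, ENNReal.toReal_ofReal hc0]

/-- **Events (marginals) obey the multiplicative lower bound**: `D_x(E) ≤ c · Pr[A(x) ∈ E]` for
every event `E`. (BJS 2011, proof of Thm. 2, eq. (6).) [cite: BremnerJozsaShepherdPRSA2011, Thm. 2 (proof, eq. (6))] -/
theorem toReal_toOuterMeasure_ge (h : A.SamplesMultiplicative D c) (hc : 1 ≤ c) (x : List Bool)
    (E : Set (List Bool)) :
    ((D x).toOuterMeasure E).toReal ≤ c * ((A.outputPMF id x).toOuterMeasure E).toReal := by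
  have hc0 : 0 ≤ c := le_trans zero_le_one hc
  have hE := toOuterMeasure_le_of_apply_le (fun y => le_apply h hc x y) E
  have hfin : ENNReal.ofReal c * (A.outputPMF id x).toOuterMeasure E ≠ ⊤ := by
    refine ENNReal.mul_ne_top ENNReal.ofReal_ne_top ?_
    rw [PMF.toOuterMeasure_apply]
    exact (A.outputPMF id x).tsum_coe_indicator_ne_top E
  calc ((D x).toOuterMeasure E).toReal
      ≤ (ENNReal.ofReal c * (A.outputPMF id x).toOuterMeasure E).toReal :=
        ENNReal.toReal_mono hfin hE
    _ = c * ((A.outputPMF id x).toOuterMeasure E).toReal := by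
        rw [ENNReal.toReal_mul, ENNReal.toReal_ofReal hc0]

/-- Positivity of the post-selection event transfers to the sampler:
`0 < D_x(P) → 0 < Pr[A(x) ∈ P]`. (BJS 2011, §2.4 (`Prob[P = 0…0] ≠ 0`) with eq. (6).) [cite: BremnerJozsaShepherdPRSA2011, Thm. 2 (proof, eq. (6))] -/
theorem toReal_toOuterMeasure_pos (h : A.SamplesMultiplicative D c) (hc : 1 ≤ c) (x : List Bool)
    {P : Set (List Bool)} (hP : 0 < ((D x).toOuterMeasure P).toReal) :
    0 < ((A.outputPMF id x).toOuterMeasure P).toReal := by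
  have h1 := toReal_toOuterMeasure_ge h hc x P
  by_contra hle
  have h0 : ((A.outputPMF id x).toOuterMeasure P).toReal = 0 :=
    le_antisymm (not_lt.1 hle) ENNReal.toReal_nonneg
  rw [h0, mul_zero] at h1
  exact absurd hP (not_lt.2 h1)

/-- **BJS eq. (8), upper half, without division**: with `J` the joint-acceptance and `P` the
post-selection event, `S̃ ≤ c² S`, i.e. `Pr_A[J] · D(P) ≤ c² · D(J) · Pr_A[P]`.
(BJS 2011, proof of Thm. 2, eqs. (7)–(8).) [cite: BremnerJozsaShepherdPRSA2011, Thm. 2 (proof, eq. (8))] -/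
theorem postselected_le (h : A.SamplesMultiplicative D c) (hc : 1 ≤ c) (x : List Bool)
    (J P : Set (List Bool)) :
    ((A.outputPMF id x).toOuterMeasure J).toReal * ((D x).toOuterMeasure P).toReal ≤
      c ^ 2 * (((D x).toOuterMeasure J).toReal * ((A.outputPMF id x).toOuterMeasure P).toReal) := by
  have hJ := toReal_toOuterMeasure_le h hc x J
  have hP := toReal_toOuterMeasure_ge h hc x P
  calc ((A.outputPMF id x).toOuterMeasure J).toReal * ((D x).toOuterMeasure P).toReal
      ≤ (c * ((D x).toOuterMeasure J).toReal) *
          (c * ((A.outputPMF id x).toOuterMeasure P).toReal) :=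
        mul_le_mul hJ hP ENNReal.toReal_nonneg (by positivity)
    _ = c ^ 2 * (((D x).toOuterMeasure J).toReal *
          ((A.outputPMF id x).toOuterMeasure P).toReal) := by ring

/-- **BJS eq. (8), lower half, without division**: `S/c² ≤ S̃`, i.e.
`D(J) · Pr_A[P] ≤ c² · Pr_A[J] · D(P)`. (BJS 2011, proof of Thm. 2, eqs. (7)–(8).) [cite: BremnerJozsaShepherdPRSA2011, Thm. 2 (proof, eq. (8))] -/
theorem postselected_ge (h : A.SamplesMultiplicative D c) (hc : 1 ≤ c) (x : List Bool)
    (J P : Set (List Bool)) :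
    ((D x).toOuterMeasure J).toReal * ((A.outputPMF id x).toOuterMeasure P).toReal ≤
      c ^ 2 * (((A.outputPMF id x).toOuterMeasure J).toReal * ((D x).toOuterMeasure P).toReal) := by
  have hJ := toReal_toOuterMeasure_ge h hc x J
  have hP := toReal_toOuterMeasure_le h hc x P
  calc ((D x).toOuterMeasure J).toReal * ((A.outputPMF id x).toOuterMeasure P).toReal
      ≤ (c * ((A.outputPMF id x).toOuterMeasure J).toReal) *
          (c * ((D x).toOuterMeasure P).toReal) :=
        mul_le_mul hJ hP ENNReal.toReal_nonneg (by positivity)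
    _ = c ^ 2 * (((A.outputPMF id x).toOuterMeasure J).toReal *
          ((D x).toOuterMeasure P).toReal) := by ring

/-- **The decision transfers** (BJS 2011, proof of Thm. 2, "combining (8) with (5)"): if under `D`
the post-selection event `P` has positive probability and the joint event `J` has conditional
probability `≥ 1 - ε` (resp. `≤ ε`), then under the sampler `P` has positive probability and `J`
has conditional probability `≥ (1-ε)/c²` (resp. `≤ c² ε`) — all written multiplicatively. [cite: BremnerJozsaShepherdPRSA2011, Thm. 2 (proof, eqs. (5) and (8))] -/
theorem postselected_decision (h : A.SamplesMultiplicative D c) (hc : 1 ≤ c) {ε : ℝ}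
    (hε : 0 ≤ ε) (x : List Bool) (J P : Set (List Bool))
    (hP : 0 < ((D x).toOuterMeasure P).toReal) :
    0 < ((A.outputPMF id x).toOuterMeasure P).toReal ∧
    ((1 - ε) * ((D x).toOuterMeasure P).toReal ≤ ((D x).toOuterMeasure J).toReal →
      (1 - ε) / c ^ 2 * ((A.outputPMF id x).toOuterMeasure P).toReal ≤
        ((A.outputPMF id x).toOuterMeasure J).toReal) ∧
    (((D x).toOuterMeasure J).toReal ≤ ε * ((D x).toOuterMeasure P).toReal →
      ((A.outputPMF id x).toOuterMeasure J).toReal ≤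
        c ^ 2 * ε * ((A.outputPMF id x).toOuterMeasure P).toReal) := by
  have hc0 : 0 < c := lt_of_lt_of_le one_pos hc
  have hc2 : 0 < c ^ 2 := by positivity
  set PA := ((A.outputPMF id x).toOuterMeasure P).toReal with hPA
  set JA := ((A.outputPMF id x).toOuterMeasure J).toReal with hJA
  set PD := ((D x).toOuterMeasure P).toReal with hPD
  set JD := ((D x).toOuterMeasure J).toReal with hJD
  have hPApos : 0 < PA := toReal_toOuterMeasure_pos h hc x hP
  have hJD_le : JD ≤ c * JA := toReal_toOuterMeasure_ge h hc x J
  have hJA_le : JA ≤ c * JD := toReal_toOuterMeasure_le h hc x J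
  have hPA_le : PA ≤ c * PD := toReal_toOuterMeasure_le h hc x P
  have hPD_le : PD ≤ c * PA := toReal_toOuterMeasure_ge h hc x P
  have hJA0 : 0 ≤ JA := ENNReal.toReal_nonneg
  refine ⟨hPApos, fun hyes => ?_, fun hno => ?_⟩
  · rw [div_mul_eq_mul_div, div_le_iff₀ hc2]
    by_cases h1ε : 1 - ε ≤ 0
    · have : (1 - ε) * PA ≤ 0 := mul_nonpos_of_nonpos_of_nonneg h1ε hPApos.le
      nlinarith
    · push Not at h1ε
      calc (1 - ε) * PA ≤ (1 - ε) * (c * PD) := by gcongr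
        _ = c * ((1 - ε) * PD) := by ring
        _ ≤ c * JD := by gcongr
        _ ≤ c * (c * JA) := by gcongr
        _ = JA * c ^ 2 := by ring
  · calc JA ≤ c * JD := hJA_le
      _ ≤ c * (ε * PD) := by gcongr
      _ ≤ c * (ε * (c * PA)) := by gcongr
      _ = c ^ 2 * ε * PA := by ring

end Literature.Computability.Complexity.RandAlg.SamplesMultiplicative

namespace Literature.Computability.QuantumComplexity

open Complexity Complexity.Classes

/-! ### Thresholds -/

/-- The transferred acceptance threshold stays above `1/2`: for `0 < c` and `c² < 2 - 2ε`,
`1/2 < (1-ε)/c²`. (BJS 2011, proof of Thm. 2: bounded error iff `c² < 1 + 2δ`, `δ = 1/2 - ε`.) [cite: BremnerJozsaShepherdPRSA2011, Thm. 2 (proof)] -/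
theorem one_half_lt_tolerance_div_sq {c ε : ℝ} (hc : 0 < c) (hcε : c ^ 2 < 2 - 2 * ε) :
    1 / 2 < (1 - ε) / c ^ 2 := by
  have hc2 : 0 < c ^ 2 := by positivity
  rw [div_lt_div_iff₀ two_pos hc2]
  linarith

/-- The transferred rejection threshold stays below `1/2`: for `0 ≤ ε` and `c² < 2 - 2ε`,
`c² ε < 1/2` (`c²ε < (2-2ε)ε ≤ 1/2` as `(1-2ε)² ≥ 0`). (BJS 2011, proof of Thm. 2.) [cite: BremnerJozsaShepherdPRSA2011, Thm. 2 (proof)] -/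
theorem sq_mul_tolerance_lt_one_half {c ε : ℝ} (hε : 0 ≤ ε) (hcε : c ^ 2 < 2 - 2 * ε) :
    c ^ 2 * ε < 1 / 2 := by
  rcases hε.eq_or_lt with h0 | hpos
  · rw [← h0, mul_zero]; norm_num
  · calc c ^ 2 * ε < (2 - 2 * ε) * ε := by gcongr
      _ ≤ 1 / 2 := by nlinarith [sq_nonneg (1 - 2 * ε)]

/-- **The transferred tolerance** `ε' := max (1 - (1-ε)/c²) (c² ε)` of the classical post-selected
computation obtained from a `c`-multiplicative simulation of a tolerance-`ε` post-selected family.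
(BJS 2011, proof of Thm. 2: the simulating family "will decide `L` with bounded error if
`c² < 1 + 2δ`".) [cite: BremnerJozsaShepherdPRSA2011, Thm. 2 (proof)] -/
noncomputable def transferredTolerance (c ε : ℝ) : ℝ :=
  max (1 - (1 - ε) / c ^ 2) (c ^ 2 * ε)

/-- For `1 ≤ c`, `0 < ε` and `c² < 2 - 2ε` the transferred tolerance lies in `(0, 1/2)`.
(BJS 2011, proof of Thm. 2.) [cite: BremnerJozsaShepherdPRSA2011, Thm. 2 (proof)] -/
theorem transferredTolerance_mem_Ioo {c ε : ℝ} (hc : 1 ≤ c) (hε : 0 < ε)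
    (hcε : c ^ 2 < 2 - 2 * ε) :
    0 < transferredTolerance c ε ∧ transferredTolerance c ε < 1 / 2 := by
  have hc0 : 0 < c := lt_of_lt_of_le one_pos hc
  have hb : 0 < c ^ 2 * ε := by positivity
  refine ⟨lt_max_of_lt_right hb, max_lt ?_ (sq_mul_tolerance_lt_one_half hε.le hcε)⟩
  have := one_half_lt_tolerance_div_sq hc0 hcε
  linarith

/-! ### Post-selected statistics of a classical sampler -/

namespace Sampler

/-- `Pr[P̃ = 0…0]`: the probability that the output of the sampler `A` on `x` lies in the IQP
post-selection event for input length `|x|` and block size `k |x|` (registers of BJS's classical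
family `C̃_w` "corresponding to" those of `C_w`). (BJS 2011, proof of Thm. 2, eq. (7).) [cite: BremnerJozsaShepherdPRSA2011, Thm. 2 (proof, eq. (7))] -/
noncomputable def postselectProb (A : RandAlg (List Bool) (List Bool)) (k : ℕ → ℕ)
    (x : List Bool) : ℝ :=
  ((A.outputPMF id x).toOuterMeasure (iqpPostselectStrings x.length (k x.length))).toReal

/-- `Pr[Õ = 1 ∧ P̃ = 0…0]` for the sampler `A` on `x` (numerator of BJS's `S̃_w(1)`).
(BJS 2011, proof of Thm. 2, eq. (7).) [cite: BremnerJozsaShepherdPRSA2011, Thm. 2 (proof, eq. (7))] -/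
noncomputable def jointAcceptProb (A : RandAlg (List Bool) (List Bool)) (k : ℕ → ℕ)
    (x : List Bool) : ℝ :=
  ((A.outputPMF id x).toOuterMeasure
    (iqpAcceptStrings x.length ∩ iqpPostselectStrings x.length (k x.length))).toReal

/-- `Sampler.PostDecides A k L ε`: post-selecting the sampler's output on the IQP register events
(block size `k`) decides `L` with tolerance `ε` — the classical analogue of
`PostIQPFamily.PostDecides` (BJS: the family `C̃_w` post-selected on `P̃_w` decides `L` with
bounded error). (BJS 2011, proof of Thm. 2, and Def. 3 (post-BPP).) [cite: BremnerJozsaShepherdPRSA2011, Thm. 2 (proof) and Def. 3] -/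
def PostDecides (A : RandAlg (List Bool) (List Bool)) (k : ℕ → ℕ) (L : Language Bool) (ε : ℝ) :
    Prop :=
  ∀ x : List Bool, 0 < postselectProb A k x ∧
    (x ∈ L → (1 - ε) * postselectProb A k x ≤ jointAcceptProb A k x) ∧
    (x ∉ L → jointAcceptProb A k x ≤ ε * postselectProb A k x)

/-- Weakening the tolerance preserves a post-selected decision. [folklore] -/
theorem PostDecides.mono {A : RandAlg (List Bool) (List Bool)} {k : ℕ → ℕ} {L : Language Bool}
    {ε ε' : ℝ} (h : PostDecides A k L ε) (hle : ε ≤ ε') : PostDecides A k L ε' := by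
  intro x
  obtain ⟨hpos, hyes, hno⟩ := h x
  refine ⟨hpos, fun hx => le_trans ?_ (hyes hx), fun hx => le_trans (hno hx) ?_⟩
  · exact mul_le_mul_of_nonneg_right (by linarith) hpos.le
  · exact mul_le_mul_of_nonneg_right hle hpos.le

end Sampler

/-- **BJS's transfer step, proved.** If the post-selected IQP family `F` decides `L` with tolerance
`ε > 0` and the sampler `A` simulates `F.kernel` to multiplicative error `c ≥ 1`, then
post-selecting `A`'s output on the same registers decides `L` with the transferred tolerance
`ε' = max (1 - (1-ε)/c²) (c²ε)` (which lies in `(0, 1/2)` when `c² < 2 - 2ε`,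
`transferredTolerance_mem_Ioo`). (BJS 2011, proof of Thm. 2, eqs. (5)–(8).) [cite: BremnerJozsaShepherdPRSA2011, Thm. 2 (proof, eqs. (5)–(8))] -/
theorem PostIQPFamily.PostDecides.samplerPostDecides {F : PostIQPFamily} {L : Language Bool}
    {ε c : ℝ} {A : RandAlg (List Bool) (List Bool)} (hF : F.PostDecides L ε)
    (hA : A.SamplesMultiplicative F.kernel c) (hc : 1 ≤ c) (hε : 0 < ε) :
    Sampler.PostDecides A F.postLen L (transferredTolerance c ε) := by
  intro x
  obtain ⟨hpos, hyes, hno⟩ := hF x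
  obtain ⟨hposA, hyesA, hnoA⟩ :=
    RandAlg.SamplesMultiplicative.postselected_decision hA hc hε.le x
      (iqpAcceptStrings x.length ∩ iqpPostselectStrings x.length (F.postLen x.length))
      (iqpPostselectStrings x.length (F.postLen x.length)) hpos
  refine ⟨hposA, fun hx => ?_, fun hx => ?_⟩
  · refine le_trans ?_ (hyesA (hyes hx))
    refine mul_le_mul_of_nonneg_right ?_ hposA.le
    have : 1 - (1 - ε) / c ^ 2 ≤ transferredTolerance c ε := le_max_left _ _
    linarith
  · refine le_trans (hnoA (hno hx)) (mul_le_mul_of_nonneg_right (le_max_right _ _) hposA.le)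

/-! ### Post-BPP at a general tolerance and the two residual named facts -/

/-- **`PostBPPWith ε`**: post-BPP at error tolerance `ε` — the tree's `PostBPP` with the
thresholds `2/3, 1/3` replaced by `1-ε, ε` (same predicates `R, S ∈ P` on the coin string, same
multiplicative form). (BJS 2011, Def. 3 (post-BPP with tolerance `ε`); Han–Hemaspaandra–Thierauf
1997, §3.) [cite: BremnerJozsaShepherdPRSA2011, Def. 3] -/
def PostBPPWith (ε : ℝ) : Set (Language Bool) :=
  {L | ∃ R ∈ P, ∃ S ∈ P, ∃ p : Polynomial ℕ, ∀ x : List Bool,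
    0 < uniformProb (p.eval x.length) {r : List Bool | boolPair x r ∈ S} ∧
    (x ∈ L → (1 - ε) * uniformProb (p.eval x.length) {r : List Bool | boolPair x r ∈ S} ≤
      uniformProb (p.eval x.length) {r : List Bool | boolPair x r ∈ S ∧ boolPair x r ∈ R}) ∧
    (x ∉ L → uniformProb (p.eval x.length) {r : List Bool | boolPair x r ∈ S ∧ boolPair x r ∈ R} ≤
      ε * uniformProb (p.eval x.length) {r : List Bool | boolPair x r ∈ S})}

/-- At tolerance `1/3` this is literally the tree's `PostBPP`. (Han–Hemaspaandra–Thierauf 1997,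
§3; Aaronson 2005, §2.) [cite: HanHemaspaandraThierauf1997, §3] -/
theorem PostBPPWith_one_third : PostBPPWith (1 / 3) = PostBPP := by
  simp only [PostBPPWith, PostBPP]
  norm_num

/-- **Residual fact 1 (definition-level plumbing).** If a *uniform* PPT sampler `A` (polynomial
time on `⟨x, r⟩`, coin budget exactly a polynomial `q`) post-selected on the IQP register events
with a polynomial-time computable block size `k` decides `L` with tolerance `ε`, then
`L ∈ PostBPPWith ε`: take `S = {⟨x,r⟩ | A.run x r ∈ post-selection event}` and
`R = {⟨x,r⟩ | A.run x r ∈ acceptance event}`, which are in `P` (run `A`, read the bits at the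
positions `0…|x|-1`, `|x|`, `|x|+1…|x|+k|x|`), with coin length `p = q`; then
`Pr_r[⟨x,r⟩ ∈ S] = Pr[A(x) ∈ post-selection event]` by definition of `RandAlg.outputPMF`. This is
BJS's reading of the simulating process as "a uniform family of classical randomised circuits
`C̃_w`" post-selected on `P̃_w` (proof of Thm. 2, with Def. 1, §2.2 and Def. 3). [cite: BremnerJozsaShepherdPRSA2011, Thm. 2 (proof, eq. (7)) with Def. 3] -/
def mem_PostBPPWith_of_samplerPostDecides : Prop :=
  ∀ (L : Language Bool) (ε : ℝ) (k : ℕ → ℕ) (A : RandAlg (List Bool) (List Bool)),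
    PolyTimeComputable unaryEncodeNat unaryEncodeNat k →
    IsPPT A id → (∃ q : Polynomial ℕ, ∀ n, A.coinLen n = q.eval n) →
    Sampler.PostDecides A k L ε → L ∈ PostBPPWith ε

/-- **Residual fact 2 (post-BPP error reduction).** Post-BPP does not depend on the error
tolerance: `PostBPPWith ε ⊆ PostBPP` for every `0 < ε < 1/2` (repeat with independent coins,
post-select on all repetitions succeeding, take the majority; Chernoff). (BJS 2011, §2.4:
"post-BPP and post-BQP are easily seen to be independent of the error tolerance value";
Han–Hemaspaandra–Thierauf 1997, Thm. 3.1 for `BPP_path`.) [cite: BremnerJozsaShepherdPRSA2011, §2.4] -/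
def PostBPPWith_subset_PostBPP : Prop :=
  ∀ ε : ℝ, 0 < ε → ε < 1 / 2 → PostBPPWith ε ⊆ PostBPP

/-- The easy half of tolerance-independence, proved: tightening the tolerance below `1/3` only
strengthens the thresholds, `PostBPPWith ε ⊆ PostBPP` for `ε ≤ 1/3`. [folklore] -/
theorem PostBPPWith_subset_PostBPP_of_le {ε : ℝ} (hε : ε ≤ 1 / 3) : PostBPPWith ε ⊆ PostBPP := by
  rintro L ⟨R, hR, S, hS, p, h⟩
  refine ⟨R, hR, S, hS, p, fun x => ?_⟩
  obtain ⟨hpos, hyes, hno⟩ := h x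
  refine ⟨hpos, fun hx => le_trans ?_ (hyes hx), fun hx => le_trans (hno hx) ?_⟩
  · exact mul_le_mul_of_nonneg_right (by linarith) hpos.le
  · exact mul_le_mul_of_nonneg_right (by linarith) hpos.le

/-- **Assembly of `mem_PostBPP_of_samplesMultiplicative`** (the argument of BJS Thm. 2) from the
proved transfer step and the two residual facts: the sampler post-selected on the family's
registers decides `L` with tolerance `ε' = transferredTolerance c ε ∈ (0, 1/2)`
(`samplerPostDecides`), hence `L ∈ PostBPPWith ε'` (fact 1, using uniformity of the block size
from `F.IsUniform` and of the sampler), hence `L ∈ PostBPP` (fact 2).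
(BJS 2011, proof of Thm. 2.) [cite: BremnerJozsaShepherdPRSA2011, Thm. 2 (proof)] -/
theorem mem_PostBPP_of_samplesMultiplicative_of (h1 : mem_PostBPPWith_of_samplerPostDecides)
    (h2 : PostBPPWith_subset_PostBPP) : mem_PostBPP_of_samplesMultiplicative := by
  intro L ε c F A hε0 _hε1 hc hcε hFu hFd hA hq hAs
  obtain ⟨hε'0, hε'1⟩ := transferredTolerance_mem_Ioo hc hε0 hcε
  exact h2 _ hε'0 hε'1 (h1 L _ F.postLen A hFu.2 hA hq (hFd.samplerPostDecides hAs hc hε0))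

end Literature.Computability.QuantumComplexity
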